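import Literature.Computability.MetaComplexity.PolynomialCalculusVariableRule
import HarnessLib

/-!
# Size–degree trade-off for the polynomial calculus, I: recombining the two restrictions of a variable

Fourth toolkit file toward the size–degree trade-off of Impagliazzo–Pudlák–Sgall
(`PolynomialCalculusSizeDegree.lean`), in the multilinear polynomial calculus `MLPC.Derivable`
of `PolynomialCalculusVariableRule.lean`.  The two COMBINATION LEMMAS of the
Clegg–Edmonds–Impagliazzo restriction argument (the polynomial-calculus analogue of
`w(F) ≤ max(w(F|_{x=0}) + 1, w(F|_{x=1}))` for resolution width):

* `MLPC.derivable_one_sub_X_of_restrict_false` — if `𝓕|_{x_j := 0}` has a refutation of degree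
  `≤ d`, then `𝓕` derives the line `1 - x_j` in degree `≤ max (d + 1) (d₀ + 1)` (`d₀` a bound on
  the degrees of the axioms): multiply every line by `1 - x_j` (and reduce); an axiom
  `ml (g|_{x_j:=0})` becomes `ml ((1 - x_j) g) = ml g - ml (x_j · ml g)`, two rule applications
  away from the axiom `ml g` of `𝓕`.
* `MLPC.derivable_of_restrict_true` — if moreover `𝓕|_{x_j := 1}` has a refutation of degree
  `≤ d₂` and `𝓕` derives `1 - x_j` in degree `≤ d₁`, then `𝓕` has a refutation of degree
  `≤ max d₁ (max d₂ d₀)`: replay the refutation of `𝓕|_{x_j:=1}`, producing each of its axioms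
  `(ml g)|_{x_j:=1} = ml g + (1 - x_j) · A` (`ml g = x_j A + B`) from `ml g` and the line `1 - x_j`
  multiplied out monomial by monomial (`MLPC.derivable_ml_monomial_mul`).

References: M. Clegg, J. Edmonds, R. Impagliazzo, Proc. 28th STOC (1996);
R. Impagliazzo, P. Pudlák, J. Sgall, Comput. Complexity 8 (1999) [ImpagliazzoPudlakSgall1999];
E. Ben-Sasson, A. Wigderson, J. ACM 48 (2001) (the resolution analogue); J. Krajíček, *Proof
Complexity* (2019), Thm. 16.2.4 [KrajicekProofComplexity2019].
-/

noncomputable section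

namespace Literature.Computability.MetaComplexity

open Finset MvPolynomial

variable {σ : Type*} {K : Type*} [Field K]

namespace MLPC

variable {𝓕 : Set (MvPolynomial σ K)}

/-! ### Multiplying a derivation by `1 - x_j` -/

/-- `ml ((1 - x_j) · f) = ml f - ml (x_j f)`. [folklore] -/
theorem ml_one_sub_X_mul (j : σ) (f : MvPolynomial σ K) :
    ml K ((1 - X j) * f) = ml K f - ml K (X j * f) := by
  rw [sub_mul, one_mul, map_sub]

/-- Degree of `ml ((1 - x_j) · f)`. [folklore] -/
theorem totalDegree_ml_one_sub_X_mul_le (j : σ) {f : MvPolynomial σ K} {d : ℕ}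
    (hf : f.totalDegree ≤ d) : (ml K ((1 - X j) * f)).totalDegree ≤ d + 1 := by
  refine (totalDegree_ml_le _).trans ((totalDegree_mul _ _).trans ?_)
  have h1 : ((1 : MvPolynomial σ K) - X j).totalDegree ≤ 1 :=
    (totalDegree_sub _ _).trans (max_le (by rw [totalDegree_one]; exact zero_le_one)
      (by rw [totalDegree_X]))
  omega

variable [DecidableEq σ]

/-- `x_j := 0` is invisible under the factor `1 - x_j`:
`ml ((1 - x_j) · g|_{x_j:=0}) = ml ((1 - x_j) · g)`. [folklore] -/
theorem ml_one_sub_X_mul_restrictVar_false (j : σ) (g : MvPolynomial σ K) :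
    ml K ((1 - X j) * restrictVar K j false g) = ml K ((1 - X j) * g) := by
  induction g using MvPolynomial.induction_on' with
  | monomial s a =>
    rw [restrictVar_false_monomial]
    split_ifs with hs
    · rfl
    · -- `x^s = x_j · x^u`, so both sides vanish
      obtain ⟨k, hk⟩ : ∃ k, s j = k + 1 := ⟨s j - 1, by omega⟩
      have hexp : s = Finsupp.single j 1 + (s.erase j + Finsupp.single j k) := by
        ext i
        by_cases hij : i = j
        · subst hij
          rw [Finsupp.add_apply, Finsupp.add_apply, Finsupp.single_eq_same, Finsupp.erase_same,
            Finsupp.single_eq_same, hk]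
          ring
        · rw [Finsupp.add_apply, Finsupp.add_apply, Finsupp.single_eq_of_ne hij,
            Finsupp.erase_ne hij, Finsupp.single_eq_of_ne hij]
          ring
      have hsu : monomial s a = X j * monomial (s.erase j + Finsupp.single j k) a := by
        rw [X, monomial_mul, one_mul, ← hexp]
      rw [mul_zero, map_zero, hsu, ml_one_sub_X_mul_X_mul]
  | add p q ihp ihq => rw [map_add, mul_add, mul_add, map_add, map_add, ihp, ihq]

/-- **Combination lemma, multiplicative half**: a derivation of `f` from `𝓕|_{x_j:=0}` with
lines of degree `≤ d` yields a derivation of `ml ((1 - x_j) f)` from `𝓕` with lines of degree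
`≤ max (d+1) (d₀+1)`, `d₀` bounding the degrees of the axioms. [Clegg–Edmonds–Impagliazzo 1996;
Impagliazzo–Pudlák–Sgall 1999] [cite: KrajicekProofComplexity2019, Thm 16.2.4 (i)] -/
theorem derivable_ml_one_sub_X_mul_of_restrict_false (j : σ) {d d₀ : ℕ}
    (h0 : ∀ g ∈ 𝓕, g.totalDegree ≤ d₀) {f : MvPolynomial σ K}
    (h : Derivable (restrictSet j false 𝓕) (fun g => g.totalDegree ≤ d) f) :
    Derivable 𝓕 (fun g => g.totalDegree ≤ max (d + 1) (d₀ + 1)) (ml K ((1 - X j) * f)) := by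
  set B := max (d + 1) (d₀ + 1) with hB
  induction h with
  | @hyp f' hf' hP =>
    obtain ⟨g, hg, rfl⟩ := hf'
    rw [ml_mul_ml, ml_one_sub_X_mul_restrictVar_false, ml_one_sub_X_mul, ← ml_mul_ml]
    have hdg : (ml K g).totalDegree ≤ B :=
      (totalDegree_ml_le g).trans ((h0 g hg).trans (by omega))
    have h1 : Derivable 𝓕 (fun g => g.totalDegree ≤ B) (ml K g) := .hyp hg hdg
    have h2 : Derivable 𝓕 (fun g => g.totalDegree ≤ B) (ml K (X j * ml K g)) := by
      refine .mulVar j h1 ((totalDegree_ml_le _).trans ((totalDegree_mul _ _).trans ?_))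
      rw [totalDegree_X]
      have := (totalDegree_ml_le g).trans (h0 g hg)
      omega
    exact h1.sub_of_degree h2
  | add hf hg hP ihf ihg =>
    rw [mul_add, map_add]
    refine .add ihf ihg ?_
    rw [← map_add, ← mul_add]
    exact (totalDegree_ml_one_sub_X_mul_le j hP).trans (by omega)
  | smul a hf hP ih =>
    rw [mul_smul_comm, map_smul]
    refine .smul a ih ?_
    rw [← map_smul, ← mul_smul_comm]
    exact (totalDegree_ml_one_sub_X_mul_le j hP).trans (by omega)
  | @mulVar f i hf hP ih =>
    have heq : ml K ((1 - X j) * ml K (X i * f)) = ml K (X i * ml K ((1 - X j) * f)) := by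
      rw [ml_mul_ml, ml_mul_ml, ← mul_assoc, ← mul_assoc, mul_comm (X i)]
    rw [heq]
    refine .mulVar i ih ?_
    rw [← heq]
    exact (totalDegree_ml_one_sub_X_mul_le j hP).trans (by omega)

/-- **`𝓕|_{x_j:=0} ⊢_d 1` implies `𝓕 ⊢_{max(d+1, d₀+1)} 1 - x_j`.**
[Clegg–Edmonds–Impagliazzo 1996; Impagliazzo–Pudlák–Sgall 1999]
[cite: KrajicekProofComplexity2019, Thm 16.2.4 (i)] -/
theorem derivable_one_sub_X_of_restrict_false (j : σ) {d d₀ : ℕ}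
    (h0 : ∀ g ∈ 𝓕, g.totalDegree ≤ d₀)
    (h : Derivable (restrictSet j false 𝓕) (fun g => g.totalDegree ≤ d) 1) :
    Derivable 𝓕 (fun g => g.totalDegree ≤ max (d + 1) (d₀ + 1)) (1 - X j) := by
  have := derivable_ml_one_sub_X_mul_of_restrict_false j h0 h
  rwa [mul_one, map_sub, ml_one, ml_X] at this

/-! ### Replaying a derivation from `𝓕|_{x_j := 1}` -/

/-- Multiplying a derived line `u` by a multilinear monomial `x^t`, one variable at a time, stays
derivable as long as `deg u + |t|` is within the degree bound. [folklore] -/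
theorem derivable_ml_monomial_mul {B : ℕ} {u : MvPolynomial σ K}
    (hu : Derivable 𝓕 (fun g => g.totalDegree ≤ B) u) :
    ∀ (S : Finset σ) (t : σ →₀ ℕ), t.support = S → mlMon t = t → u.totalDegree + S.card ≤ B →
      Derivable 𝓕 (fun g => g.totalDegree ≤ B) (ml K (monomial t 1 * u)) := by
  intro S
  induction S using Finset.induction_on with
  | empty =>
    intro t ht _ _
    rw [Finsupp.support_eq_empty.1 ht]
    change Derivable 𝓕 _ (ml K (1 * u))
    rw [one_mul, hu.ml_eq]
    exact hu
  | insert i S hi ih =>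
    intro t ht hml hB
    have hti : t i = 1 := by
      have h1 : t i ≤ 1 := (mlMon_eq_self_iff t).1 hml i
      have h2 : t i ≠ 0 := Finsupp.mem_support_iff.1 (by rw [ht]; exact Finset.mem_insert_self i S)
      omega
    set t' := t.erase i with ht'
    have ht's : t'.support = S := by
      rw [ht', Finsupp.support_erase, ht, Finset.erase_insert hi]
    have hml' : mlMon t' = t' := by
      rw [ht', mlMon_erase, hml]
    have htt : t = t' + Finsupp.single i 1 := by rw [ht', ← hti, Finsupp.erase_add_single]
    have hcard : S.card + 1 = (insert i S).card := (Finset.card_insert_of_notMem hi).symm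
    have hih := ih t' ht's hml' (by omega)
    have heq : ml K (monomial t (1 : K) * u) = ml K (X i * ml K (monomial t' 1 * u)) := by
      rw [ml_mul_ml, ← mul_assoc, X, monomial_mul, one_mul, add_comm, ← htt]
    rw [heq]
    refine .mulVar i hih ?_
    refine (totalDegree_ml_le _).trans ((totalDegree_mul _ _).trans ?_)
    rw [totalDegree_X]
    have h1 : (ml K (monomial t' (1 : K) * u)).totalDegree ≤ S.card + u.totalDegree := by
      refine (totalDegree_ml_le _).trans ((totalDegree_mul _ _).trans ?_)
      refine Nat.add_le_add_right ((totalDegree_monomial_le _ _).trans ?_) _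
      rw [sum_id_eq_degree, degree_eq_card_support_of_mlMon_eq hml', ht's]
    omega

/-- The decomposition behind the replay: for multilinear `gm`,
`gm|_{x_j:=1} = gm + Σ_{s ∋ x_j} c_s · ml (x^{s∖j} (1 - x_j))`. [folklore] -/
theorem restrictVar_true_eq_add_sum {gm : MvPolynomial σ K} (hgm : ml K gm = gm) (j : σ) :
    restrictVar K j true gm = gm + ∑ s ∈ gm.support with s j ≠ 0,
      coeff s gm • ml K (monomial (s.erase j) 1 * (1 - X j)) := by
  -- each summand is `c_s (x^{s∖j} - x^s)`
  have hterm : ∀ s ∈ gm.support.filter (fun s => s j ≠ 0),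
      coeff s gm • ml K (monomial (s.erase j) (1 : K) * (1 - X j)) =
        monomial (s.erase j) (coeff s gm) - monomial s (coeff s gm) := by
    intro s hs
    rw [Finset.mem_filter] at hs
    have hsj : s j = 1 := by
      have := (mlMon_eq_self_iff s).1 (mlMon_eq_of_ml_eq_self hgm hs.1) j
      omega
    have hml_e : mlMon (s.erase j) = s.erase j := by
      rw [mlMon_erase, mlMon_eq_of_ml_eq_self hgm hs.1]
    have hml_s : mlMon s = s := mlMon_eq_of_ml_eq_self hgm hs.1
    rw [mul_sub, mul_one, map_sub, ml_monomial, hml_e, X, monomial_mul, mul_one, ml_monomial,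
      ← hsj, Finsupp.erase_add_single, hml_s, smul_sub, smul_monomial, smul_monomial, smul_eq_mul,
      mul_one]
  rw [Finset.sum_congr rfl hterm, Finset.sum_sub_distrib]
  set A := ∑ s ∈ gm.support with s j ≠ 0, monomial (s.erase j) (coeff s gm) with hA
  set B := ∑ s ∈ gm.support with s j ≠ 0, monomial s (coeff s gm) with hB
  set C := ∑ s ∈ gm.support with ¬ s j ≠ 0, monomial s (coeff s gm) with hC
  have hsplit : B + C = gm :=
    (Finset.sum_filter_add_sum_filter_not gm.support (fun s => s j ≠ 0)
      (fun s => monomial s (coeff s gm))).trans gm.as_sum.symm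
  have hsplit1 : A + ∑ s ∈ gm.support with ¬ s j ≠ 0, monomial (s.erase j) (coeff s gm) =
      ∑ s ∈ gm.support, monomial (s.erase j) (coeff s gm) :=
    Finset.sum_filter_add_sum_filter_not gm.support (fun s => s j ≠ 0)
      (fun s => monomial (s.erase j) (coeff s gm))
  have hsame : ∑ s ∈ gm.support with ¬ s j ≠ 0, monomial (s.erase j) (coeff s gm) = C := by
    refine Finset.sum_congr rfl fun s hs => ?_
    rw [Finset.mem_filter, not_not] at hs
    have hes : s.erase j = s := by
      ext i
      by_cases hij : i = j
      · rw [hij, Finsupp.erase_same, hs.2]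
      · rw [Finsupp.erase_ne hij]
    rw [hes]
  rw [restrictVar_true_eq_sum, ← hsplit1, hsame, ← hsplit]
  abel

/-- **Combination lemma, replay half**: if `𝓕` derives `1 - x_j` with lines of degree `≤ d₁`
and `𝓕|_{x_j:=1}` derives `f` with lines of degree `≤ d₂`, then `𝓕` derives `f` with lines of
degree `≤ max d₁ (max d₂ d₀)` (`d₀` bounding the degrees of the axioms).
[Clegg–Edmonds–Impagliazzo 1996; Impagliazzo–Pudlák–Sgall 1999]
[cite: KrajicekProofComplexity2019, Thm 16.2.4 (i)] -/
theorem derivable_of_restrict_true (j : σ) {d₁ d₂ d₀ : ℕ}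
    (h0 : ∀ g ∈ 𝓕, g.totalDegree ≤ d₀)
    (hX : Derivable 𝓕 (fun g => g.totalDegree ≤ d₁) (1 - X j)) {f : MvPolynomial σ K}
    (h : Derivable (restrictSet j true 𝓕) (fun g => g.totalDegree ≤ d₂) f) :
    Derivable 𝓕 (fun g => g.totalDegree ≤ max d₁ (max d₂ d₀)) f := by
  set B := max d₁ (max d₂ d₀) with hB
  have hXB : Derivable 𝓕 (fun g => g.totalDegree ≤ B) (1 - X j) :=
    hX.mono fun g _ hg => hg.trans (by omega)
  have h1X : ((1 : MvPolynomial σ K) - X j).totalDegree ≤ 1 :=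
    (totalDegree_sub _ _).trans (max_le (by rw [totalDegree_one]; exact zero_le_one)
      (by rw [totalDegree_X]))
  induction h with
  | @hyp f' hf' hP =>
    obtain ⟨g, hg, rfl⟩ := hf'
    rw [ml_restrictVar]
    set gm := ml K g with hgmdef
    have hgm : ml K gm = gm := ml_ml g
    have hdeggm : gm.totalDegree ≤ d₀ := (totalDegree_ml_le g).trans (h0 g hg)
    have hgmD : Derivable 𝓕 (fun g => g.totalDegree ≤ B) gm := .hyp hg (hdeggm.trans (by omega))
    have hfin : (restrictVar K j true gm).totalDegree ≤ B :=
      (totalDegree_restrictVar_le j true gm).trans (hdeggm.trans (by omega))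
    rw [restrictVar_true_eq_add_sum hgm j] at hfin ⊢
    by_cases hSe : gm.support.filter (fun s => s j ≠ 0) = ∅
    · rw [hSe, Finset.sum_empty, add_zero]; exact hgmD
    refine .add hgmD (Derivable.sum_smul (Finset.nonempty_iff_ne_empty.2 hSe) _ _
      fun s hs => ?_) hfin
    -- each `ml (x^{s∖j} (1 - x_j))` from the line `1 - x_j`
    rw [Finset.mem_filter] at hs
    have hml_s : mlMon s = s := mlMon_eq_of_ml_eq_self hgm hs.1
    refine derivable_ml_monomial_mul hXB _ (s.erase j) rfl (by rw [mlMon_erase, hml_s]) ?_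
    have hcard : (s.erase j).support.card + 1 = s.support.card := by
      rw [Finsupp.support_erase, Finset.card_erase_of_mem (Finsupp.mem_support_iff.2 hs.2)]
      have := Finset.card_pos.2 ⟨j, Finsupp.mem_support_iff.2 hs.2⟩
      omega
    have := card_support_le_totalDegree_of_ml_eq_self hgm hs.1
    omega
  | add hf hg hP ihf ihg => exact .add ihf ihg (hP.trans (by omega))
  | smul a hf hP ih => exact .smul a ih (hP.trans (by omega))
  | mulVar i hf hP ih => exact .mulVar i ih (hP.trans (by omega))

end MLPC

end Literature.Computability.MetaComplexity
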